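import Literature.AlgebraicGeometry.Frobenioids.ArchimedeanFSMIrreducible
import HarnessLib

/-!
# Frobenioids II, Proposition 3.4 (iv): PROOF (abc-iut cell, layer L1, node `FrdII:Prop3.4(iv)`,
# sub-node `FrdII:Prop3.4(iv)/P34-L05`, chain LC-L1-2)

Mochizuki, *The geometry of Frobenioids II: poly-Frobenioids*, Kyushu J. Math. **62** (2008)
401–460, §3, Proposition 3.4 (iv) p. 30, proof p. 31 ll. 13–24
[cite: MochizukiFrdII2008, Prop 3.4 (iv) p.30].
PROOF-ONLY companion of `ArchimedeanFSM.lean` (statements, seat abc-iut-L1-t6); nothing is defined here.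

> "(iv) Suppose that `D` is complexifiable. Then any FSM-morphism (respectively, FSMI-morphism) of
> `F` that projects to an isomorphism of `D` projects to an FSM-morphism (respectively,
> FSMI-morphism) of `F₀`."  (`F ∈ {A, N, R}`, `F₀ ∈ {A₀, N₀, R₀}`.)

Proof (p. 31, "lift pairs `α₀, β₀` with `φ₀ ∘ α₀ = φ₀ ∘ β₀`; lift `γ₀ : C₀ → B₀`; irreducibility"),
rendered through the presentation `F ≅ F₀ ×_{D₀} D` (Ex. 3.3 (iii)/(iv)): let `φ = (φ₀, φ_D)` with
`φ_D` an isomorphism of `D`.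
* *Lifting arrows of `F₀`.* An arrow `α₀ : Z₀ → X₀` of `F₀` into the `F₀`-projection of `X ∈ Ob(F)`
  lifts to an arrow `Z → X` of `F` with `F₀`-projection `α₀`: if `Base(α₀)` is an isomorphism of `D₀`,
  over the identity of `X_D`; if `Base(α₀)` is `Spec ℂ → Spec ℝ`, over the complex object of `D` above
  the [real] object `X_D` supplied by the COMPLEXIFIABILITY of `D` (Def. 3.1 (v)) — any two such
  compatibility squares into a real object of `D₀` agree. Two arrows `α₀, β₀` with the same base lift
  over the SAME arrow of `D` (`Tower` hypothesis `hpair`).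
* *Monomorphism.* If `α₀ ≫ φ₀ = β₀ ≫ φ₀` then `Base(α₀) = Base(β₀)` (`Base(φ₀)` is an isomorphism,
  being conjugate to `π(φ_D)`), so `α₀, β₀` lift to `α, β` over one arrow of `D`; then
  `α ≫ φ = β ≫ φ` (an arrow of `F` is determined by its two projections), hence `α = β`, `α₀ = β₀`.
* *Fiberwise surjectivity.* Lift `γ₀ : W₀ → Y₀` to `γ : W → Y`, complete the square in `F`, project.
* *Irreducibility.* `φ₀` is not an isomorphism (else `φ` would be one, isomorphisms of `F` being
  detected by the two projections); a factorization `φ₀ = β₀ ≫ α₀` has `Base(α₀)`, `Base(β₀)`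
  isomorphisms (`D₀` is totally epimorphic) and lifts to `φ = (β₀, φ_D) ≫ (α₀, id)`, so that one of the
  two factors is an isomorphism of `F`, whence of `F₀`.
The deduction is the generic `Tower.isFSM_toF0_of_lifts`; the tower facts are proved for `A`, `N`
(wide subcategories of `C = C₀ ×_{D₀} D`) and `R = R₀ ×_{D₀} D`, reusing abc-iut-w4-d092's
`A.isIso_of_isIso_proj` / `N.…` / `R.…` (`ArchimedeanFSMIrreducible.lean`). Result:
**`prop34_iv_holds : Prop34_iv π`** — item (iv) AS TYPED, for every base `π : D → D₀` (the
complexifiability hypothesis is part of the typed statement; total epimorphicity of `D` is not needed).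
No statement of the paper is strengthened; no side is taken on [IUTchIII] Cor. 3.12.
-/

namespace Literature.AlgebraicGeometry.Frobenioids

open CategoryTheory

namespace ArchFrd

universe v u

/-! ### Two elementary facts about the skeleton `D₀` -/

namespace D0

/-- Every arrow of `D₀` is either an isomorphism or the structure arrow `Spec ℂ → Spec ℝ` (up to the
names of its source and target). [cite: MochizukiFrdII2008, §3 p.23] -/
theorem isIso_or_eq {L K : D0} (f : L ⟶ K) : IsIso f ∨ (L = complex ∧ K = real) := by
  cases f with
  | idReal => exact Or.inl (inferInstance : IsIso (𝟙 real))
  | toReal => exact Or.inr ⟨rfl, rfl⟩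
  | gal σ => exact Or.inl ⟨⟨Hom.gal σ, by cases σ <;> rfl, by cases σ <;> rfl⟩⟩

/-- The target of an isomorphism of `D₀` out of `Spec ℝ` is `Spec ℝ`. [cite: MochizukiFrdII2008, §3 p.23] -/
theorem eq_real_of_iso {K : D0} (e : real ≅ K) : K = real := by
  cases K with
  | real => rfl
  | complex => exact (isEmpty_hom_real_complex.false e.hom).elim

end D0

/-! ### Generic: item (iv) for a tower from lifting properties -/

namespace Tower

variable {D : Type u} [Category.{v} D] {π : D ⥤ D0} (T : Tower π)

/-- **Prop. 3.4 (iv), proof** (FrdII p. 31 ll. 13–24), generic form. Suppose that, for a tower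
`F → D`, `F → F₀ → D₀`: (a) an arrow of `F` whose two projections are isomorphisms is an isomorphism;
(b) an arrow of `F` over an isomorphism of `D` has `F₀`-projection over an isomorphism of `D₀`;
(c) an arrow of `F` is determined by its two projections; (d) two arrows `α₀, β₀ : Z₀ → X₀` of `F₀`
into the projection of `X ∈ Ob(F)` with the same base lift to arrows `Z → X` of `F` over ONE arrow of
`D`; (e) a factorization in `F₀` of the projection of an arrow `φ` of `F` over an isomorphism of `D`
lifts to a factorization of `φ`. Then an FSM-morphism (resp. FSMI-morphism) `φ` of `F` projecting to an
isomorphism of `D` projects to an FSM-morphism (resp. FSMI-morphism) of `F₀`.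
[cite: MochizukiFrdII2008, Prop 3.4 (iv) p.31] -/
theorem isFSM_toF0_of_lifts
    (hrefl : ∀ ⦃X Y : T.F⦄ (φ : X ⟶ Y), IsIso (T.toD.map φ) → IsIso (T.toF0.map φ) → IsIso φ)
    (hbase : ∀ ⦃X Y : T.F⦄ (φ : X ⟶ Y), IsIso (T.toD.map φ) → IsIso (T.base0.map (T.toF0.map φ)))
    (hfaith : ∀ ⦃X Y : T.F⦄ (f g : X ⟶ Y), T.toF0.map f = T.toF0.map g → T.toD.map f = T.toD.map g →
      f = g)
    (hpair : ∀ (X : T.F) ⦃Z₀ : T.F0⦄ (α₀ β₀ : Z₀ ⟶ T.toF0.obj X), T.base0.map α₀ = T.base0.map β₀ →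
      ∃ (Z : T.F) (e : T.toF0.obj Z = Z₀) (α β : Z ⟶ X), T.toF0.map α = eqToHom e ≫ α₀ ∧
        T.toF0.map β = eqToHom e ≫ β₀ ∧ T.toD.map α = T.toD.map β)
    (hfac : ∀ ⦃X Y : T.F⦄ (φ : X ⟶ Y), IsIso (T.toD.map φ) →
      ∀ ⦃M₀ : T.F0⦄ (β₀ : T.toF0.obj X ⟶ M₀) (α₀ : M₀ ⟶ T.toF0.obj Y), β₀ ≫ α₀ = T.toF0.map φ →
        ∃ (M : T.F) (e : T.toF0.obj M = M₀) (β : X ⟶ M) (α : M ⟶ Y), β ≫ α = φ ∧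
          T.toF0.map β = β₀ ≫ eqToHom e.symm ∧ T.toF0.map α = eqToHom e ≫ α₀)
    {X Y : T.F} (φ : X ⟶ Y) (hφD : IsIso (T.toD.map φ)) :
    (IsFSM φ → IsFSM (T.toF0.map φ)) ∧ (IsFSMI φ → IsFSMI (T.toF0.map φ)) := by
  have hb : IsIso (T.base0.map (T.toF0.map φ)) := hbase φ hφD
  have hFSM : IsFSM φ → IsFSM (T.toF0.map φ) := by
    intro hφ
    refine ⟨fun W₀ γ₀ => ?_, ⟨fun α₀ β₀ h => ?_⟩⟩
    · -- fiberwise surjectivity: lift `γ₀`, complete the square in `F`, project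
      obtain ⟨W, e, γ, -, hγ, -, -⟩ := hpair Y γ₀ γ₀ rfl
      obtain ⟨V, δ₁, δ₂, hδ⟩ := hφ.1 γ
      refine ⟨T.toF0.obj V, T.toF0.map δ₁, T.toF0.map δ₂ ≫ eqToHom e, ?_⟩
      rw [← Functor.map_comp, hδ, Functor.map_comp, hγ, Category.assoc]
    · -- monomorphism: lift the pair over one arrow of `D`
      have hb0 : T.base0.map α₀ = T.base0.map β₀ := by
        haveI := hb
        rw [← cancel_mono (T.base0.map (T.toF0.map φ)), ← Functor.map_comp, h, Functor.map_comp]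
      obtain ⟨Z, e, α, β, hα, hβ, hD⟩ := hpair X α₀ β₀ hb0
      haveI := hφ.2
      have hαβ : α = β := by
        rw [← cancel_mono φ]
        apply hfaith
        · rw [Functor.map_comp, Functor.map_comp, hα, hβ, Category.assoc, Category.assoc, h]
        · rw [Functor.map_comp, Functor.map_comp, hD]
      have hαβ₀ : eqToHom e ≫ α₀ = eqToHom e ≫ β₀ := by rw [← hα, ← hβ, hαβ]
      exact (cancel_epi _).mp hαβ₀
  refine ⟨hFSM, fun hφ => ⟨hFSM hφ.1, fun hiso => hφ.2.1 (hrefl φ hφD hiso), ?_⟩⟩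
  intro M₀ β₀ α₀ hfacφ
  obtain ⟨M, e, β, α, hcomp, hβ, hα⟩ := hfac φ hφD β₀ α₀ hfacφ
  rcases hφ.2.2 β α hcomp with hαi | hβi
  · left
    haveI := hαi
    have hi : IsIso (T.toF0.map α) := inferInstance
    rw [hα] at hi
    exact IsIso.of_isIso_comp_left (eqToHom e) α₀
  · right
    haveI := hβi
    have hi : IsIso (T.toF0.map β) := inferInstance
    rw [hβ] at hi
    exact IsIso.of_isIso_comp_right β₀ (eqToHom e.symm)

end Tower

variable {D : Type u} [Category.{v} D] (π : D ⥤ D0)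

/-! ### The base-change step: an arrow of `D₀` into the base of an object of `D` lifts to `D` -/

/-- **Lifting bases** (the only place where complexifiability enters): for `d ∈ Ob(D)` with
`π(d) ≅ K'` and an arrow `b₀ : K → K'` of `D₀`, there are `d' ∈ Ob(D)`, `g : d' → d` and `K ≅ π(d')`
making the square commute — over the identity of `d` if `b₀` is an isomorphism, and over the complex
object above the real object `d` given by Def. 3.1 (v) if `b₀` is `Spec ℂ → Spec ℝ`.
[cite: MochizukiFrdII2008, Prop 3.4 (iv) p.31] -/
theorem exists_lift_base (hC : RC.IsComplexifiable (π ⋙ D0.toArchBase)) (d : D) {K K' : D0}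
    (j : K' ≅ π.obj d) (b₀ : K ⟶ K') :
    ∃ (d' : D) (g : d' ⟶ d) (i : K ≅ π.obj d'), b₀ ≫ j.hom = i.hom ≫ π.map g := by
  rcases D0.isIso_or_eq b₀ with hb | ⟨hK, hK'⟩
  · haveI := hb
    exact ⟨d, 𝟙 d, asIso b₀ ≪≫ j, by simp⟩
  · subst hK
    subst hK'
    have hd : π.obj d = D0.real := D0.eq_real_of_iso j
    obtain ⟨d', g, -, hc, -, -⟩ := hC.exists_complex d ((D0.realObjects_comp_iff π d).mpr hd)
    have hd' : π.obj d' = D0.complex := (D0.complexObjects_comp_iff π d').mp hc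
    haveI : Subsingleton (D0.complex ⟶ π.obj d) := by rw [hd]; infer_instance
    exact ⟨d', g, eqToIso hd'.symm, Subsingleton.elim _ _⟩

/-- In `D₀` the two factors of an invertible composite are invertible (`D₀` is totally epimorphic).
[cite: MochizukiFrdII2008, §3 p.23] -/
theorem D0.isIso_and_isIso_of_isIso_comp {L M K : D0} (f : L ⟶ M) (g : M ⟶ K)
    (h : IsIso (f ≫ g)) : IsIso g ∧ IsIso f := by
  haveI := h
  exact D0.isTotallyEpimorphic.isIso_of_isIso_comp f g

/-! ### The tower facts for `F = A` -/

/-- (b) for `A`: an arrow of `A` over an isomorphism of `D` has `A₀`-projection over an isomorphism of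
`D₀` (the compatibility square of `C₀ ×_{D₀} D`). [cite: MochizukiFrdII2008, Prop 3.4 (iv) p.31] -/
theorem A.isIso_base0_of_isIso_toD {X Y : A π} (φ : X ⟶ Y) (h : IsIso ((towerA π).toD.map φ)) :
    IsIso ((towerA π).base0.map ((towerA π).toF0.map φ)) := by
  haveI : IsIso φ.hom.snd := h
  have w : (PreFrobenioid.baseFunctor C0.toElem).map φ.hom.fst =
      X.obj.iso.hom ≫ π.map φ.hom.snd ≫ Y.obj.iso.inv := by
    rw [← Category.assoc, ← φ.hom.w, Category.assoc, Iso.hom_inv_id, Category.comp_id]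
  change IsIso ((PreFrobenioid.baseFunctor C0.toElem).map φ.hom.fst)
  rw [w]
  infer_instance

/-- (c) for `A`: an arrow of `A ⊆ C₀ ×_{D₀} D` is determined by its two projections.
[cite: MochizukiFrdII2008, Prop 3.4 (iv) p.31] -/
theorem A.eq_of_proj_eq {X Y : A π} (f g : X ⟶ Y) (h0 : (towerA π).toF0.map f = (towerA π).toF0.map g)
    (hD : (towerA π).toD.map f = (towerA π).toD.map g) : f = g := by
  have h0' : f.hom.fst = g.hom.fst := congrArg (fun k => k.hom) h0
  exact WideSubcategory.hom_ext _ (CFP.hom_ext h0' hD)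

/-- (d) for `A`: two arrows of `A₀` with the same base, into the projection of an object of `A`, lift to
arrows of `A` over one arrow of `D` (complexifiable `D`). [cite: MochizukiFrdII2008, Prop 3.4 (iv) p.31] -/
theorem A.exists_lift_pair (hC : RC.IsComplexifiable (π ⋙ D0.toArchBase)) (X : A π) ⦃Z₀ : A0⦄
    (α₀ β₀ : Z₀ ⟶ (towerA π).toF0.obj X) (hb : (towerA π).base0.map α₀ = (towerA π).base0.map β₀) :
    ∃ (Z : A π) (e : (towerA π).toF0.obj Z = Z₀) (α β : Z ⟶ X),
      (towerA π).toF0.map α = eqToHom e ≫ α₀ ∧ (towerA π).toF0.map β = eqToHom e ≫ β₀ ∧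
        (towerA π).toD.map α = (towerA π).toD.map β := by
  obtain ⟨d', g, i, w⟩ := exists_lift_base π hC X.obj.snd X.obj.iso (C0.Base α₀.hom)
  have wα : (PreFrobenioid.baseFunctor C0.toElem).map α₀.hom ≫ X.obj.iso.hom = i.hom ≫ π.map g := w
  have wβ : (PreFrobenioid.baseFunctor C0.toElem).map β₀.hom ≫ X.obj.iso.hom = i.hom ≫ π.map g := by
    rw [← w]; exact congrArg (· ≫ X.obj.iso.hom) hb.symm
  let Z : C π := ⟨Z₀.obj, d', i⟩
  let a : Z ⟶ X.obj := ⟨α₀.hom, g, wα⟩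
  let b : Z ⟶ X.obj := ⟨β₀.hom, g, wβ⟩
  have ha : PreFrobenioid.isometricMorphisms (C.toElem π) a := by
    have h : PreFrobenioid.Div C0.toElem α₀.hom = 1 := α₀.property
    change pull _ _ (PreFrobenioid.Div C0.toElem α₀.hom) = 1
    rw [h, map_one]
  have hb' : PreFrobenioid.isometricMorphisms (C.toElem π) b := by
    have h : PreFrobenioid.Div C0.toElem β₀.hom = 1 := β₀.property
    change pull _ _ (PreFrobenioid.Div C0.toElem β₀.hom) = 1
    rw [h, map_one]
  exact ⟨⟨Z⟩, rfl, ⟨a, ha⟩, ⟨b, hb'⟩, (Category.id_comp _).symm, (Category.id_comp _).symm, rfl⟩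

/-- (e) for `A`: a factorization in `A₀` of the projection of an arrow `φ` of `A` over an isomorphism of
`D` lifts to a factorization of `φ` (middle object over the target's `D`-component).
[cite: MochizukiFrdII2008, Prop 3.4 (iv) p.31] -/
theorem A.exists_lift_fac {X Y : A π} (φ : X ⟶ Y) (hφD : IsIso ((towerA π).toD.map φ)) ⦃M₀ : A0⦄
    (β₀ : (towerA π).toF0.obj X ⟶ M₀) (α₀ : M₀ ⟶ (towerA π).toF0.obj Y)
    (hfac : β₀ ≫ α₀ = (towerA π).toF0.map φ) :
    ∃ (M : A π) (e : (towerA π).toF0.obj M = M₀) (β : X ⟶ M) (α : M ⟶ Y), β ≫ α = φ ∧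
      (towerA π).toF0.map β = β₀ ≫ eqToHom e.symm ∧ (towerA π).toF0.map α = eqToHom e ≫ α₀ := by
  have hfac' : β₀.hom ≫ α₀.hom = φ.hom.fst := congrArg (fun k => k.hom) hfac
  have hbφ : IsIso ((PreFrobenioid.baseFunctor C0.toElem).map φ.hom.fst) :=
    A.isIso_base0_of_isIso_toD π φ hφD
  have hcomp : IsIso ((PreFrobenioid.baseFunctor C0.toElem).map β₀.hom ≫
      (PreFrobenioid.baseFunctor C0.toElem).map α₀.hom) := by
    rw [← Functor.map_comp, hfac']; exact hbφ
  obtain ⟨hαi, -⟩ := D0.isIso_and_isIso_of_isIso_comp _ _ hcomp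
  haveI := hαi
  let j : (PreFrobenioid.baseFunctor C0.toElem).obj M₀.obj ≅ π.obj Y.obj.snd :=
    asIso ((PreFrobenioid.baseFunctor C0.toElem).map α₀.hom) ≪≫ Y.obj.iso
  let M : C π := ⟨M₀.obj, Y.obj.snd, j⟩
  have wα : (PreFrobenioid.baseFunctor C0.toElem).map α₀.hom ≫ Y.obj.iso.hom =
      j.hom ≫ π.map (𝟙 Y.obj.snd) := by simp [j]
  have wβ : (PreFrobenioid.baseFunctor C0.toElem).map β₀.hom ≫ j.hom =
      X.obj.iso.hom ≫ π.map φ.hom.snd := by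
    simp only [j, Iso.trans_hom, asIso_hom]
    rw [← Category.assoc, ← Functor.map_comp, hfac']
    exact φ.hom.w
  let a : M ⟶ Y.obj := ⟨α₀.hom, 𝟙 _, wα⟩
  let b : X.obj ⟶ M := ⟨β₀.hom, φ.hom.snd, wβ⟩
  have ha : PreFrobenioid.isometricMorphisms (C.toElem π) a := by
    have h : PreFrobenioid.Div C0.toElem α₀.hom = 1 := α₀.property
    change pull _ _ (PreFrobenioid.Div C0.toElem α₀.hom) = 1
    rw [h, map_one]
  have hb : PreFrobenioid.isometricMorphisms (C.toElem π) b := by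
    have h : PreFrobenioid.Div C0.toElem β₀.hom = 1 := β₀.property
    change pull _ _ (PreFrobenioid.Div C0.toElem β₀.hom) = 1
    rw [h, map_one]
  refine ⟨⟨M⟩, rfl, ⟨b, hb⟩, ⟨a, ha⟩, ?_, (Category.comp_id _).symm, (Category.id_comp _).symm⟩
  exact WideSubcategory.hom_ext _ (CFP.hom_ext hfac' (Category.comp_id _))

/-- **Proposition 3.4 (iv) for `F = A`**, as typed. [cite: MochizukiFrdII2008, Prop 3.4 (iv) p.30] -/
theorem A.propIV : (towerA π).PropIV := fun hC _ _ φ hφD =>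
  (towerA π).isFSM_toF0_of_lifts (fun _ _ ψ hD h0 => A.isIso_of_isIso_proj π ψ hD h0)
    (fun _ _ ψ => A.isIso_base0_of_isIso_toD π ψ) (fun _ _ f g => A.eq_of_proj_eq π f g)
    (fun X _ α₀ β₀ => A.exists_lift_pair π hC X α₀ β₀) (fun _ _ ψ hψ => A.exists_lift_fac π ψ hψ) φ hφD

/-! ### The tower facts for `F = N` -/

/-- (b) for `N`. [cite: MochizukiFrdII2008, Prop 3.4 (iv) p.31] -/
theorem N.isIso_base0_of_isIso_toD {X Y : N π} (φ : X ⟶ Y) (h : IsIso ((towerN π).toD.map φ)) :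
    IsIso ((towerN π).base0.map ((towerN π).toF0.map φ)) :=
  A.isIso_base0_of_isIso_toD π φ.hom h

/-- (c) for `N`: an arrow of `N ⊆ A` is determined by its two projections.
[cite: MochizukiFrdII2008, Prop 3.4 (iv) p.31] -/
theorem N.eq_of_proj_eq {X Y : N π} (f g : X ⟶ Y) (h0 : (towerN π).toF0.map f = (towerN π).toF0.map g)
    (hD : (towerN π).toD.map f = (towerN π).toD.map g) : f = g := by
  have h0' : f.hom.hom.fst = g.hom.hom.fst := congrArg (fun k => k.hom.hom) h0
  exact WideSubcategory.hom_ext _ (WideSubcategory.hom_ext _ (CFP.hom_ext h0' hD))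

/-- (d) for `N`: two arrows of `N₀` with the same base, into the projection of an object of `N`, lift to
arrows of `N` over one arrow of `D` (complexifiable `D`). [cite: MochizukiFrdII2008, Prop 3.4 (iv) p.31] -/
theorem N.exists_lift_pair (hC : RC.IsComplexifiable (π ⋙ D0.toArchBase)) (X : N π) ⦃Z₀ : N0⦄
    (α₀ β₀ : Z₀ ⟶ (towerN π).toF0.obj X) (hb : (towerN π).base0.map α₀ = (towerN π).base0.map β₀) :
    ∃ (Z : N π) (e : (towerN π).toF0.obj Z = Z₀) (α β : Z ⟶ X),
      (towerN π).toF0.map α = eqToHom e ≫ α₀ ∧ (towerN π).toF0.map β = eqToHom e ≫ β₀ ∧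
        (towerN π).toD.map α = (towerN π).toD.map β := by
  obtain ⟨d', g, i, w⟩ := exists_lift_base π hC X.obj.obj.snd X.obj.obj.iso (C0.Base α₀.hom.hom)
  have wα : (PreFrobenioid.baseFunctor C0.toElem).map α₀.hom.hom ≫ X.obj.obj.iso.hom =
      i.hom ≫ π.map g := w
  have wβ : (PreFrobenioid.baseFunctor C0.toElem).map β₀.hom.hom ≫ X.obj.obj.iso.hom =
      i.hom ≫ π.map g := by
    rw [← w]; exact congrArg (· ≫ X.obj.obj.iso.hom) hb.symm
  let Z : C π := ⟨Z₀.obj.obj, d', i⟩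
  let a : Z ⟶ X.obj.obj := ⟨α₀.hom.hom, g, wα⟩
  let b : Z ⟶ X.obj.obj := ⟨β₀.hom.hom, g, wβ⟩
  have ha : PreFrobenioid.isometricMorphisms (C.toElem π) a := by
    have h : PreFrobenioid.Div C0.toElem α₀.hom.hom = 1 := α₀.hom.property
    change pull _ _ (PreFrobenioid.Div C0.toElem α₀.hom.hom) = 1
    rw [h, map_one]
  have hb' : PreFrobenioid.isometricMorphisms (C.toElem π) b := by
    have h : PreFrobenioid.Div C0.toElem β₀.hom.hom = 1 := β₀.hom.property
    change pull _ _ (PreFrobenioid.Div C0.toElem β₀.hom.hom) = 1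
    rw [h, map_one]
  let a' : (⟨Z⟩ : A π) ⟶ X.obj := ⟨a, ha⟩
  let b' : (⟨Z⟩ : A π) ⟶ X.obj := ⟨b, hb'⟩
  have hal : PreFrobenioid.linearMorphisms (A.toElem π) a' := by
    have h : C0.degFr α₀.hom.hom = 1 := α₀.property
    exact h
  have hbl : PreFrobenioid.linearMorphisms (A.toElem π) b' := by
    have h : C0.degFr β₀.hom.hom = 1 := β₀.property
    exact h
  exact ⟨⟨⟨Z⟩⟩, rfl, ⟨a', hal⟩, ⟨b', hbl⟩, (Category.id_comp _).symm, (Category.id_comp _).symm, rfl⟩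

/-- (e) for `N`: a factorization in `N₀` of the projection of an arrow `φ` of `N` over an isomorphism of
`D` lifts to a factorization of `φ`. [cite: MochizukiFrdII2008, Prop 3.4 (iv) p.31] -/
theorem N.exists_lift_fac {X Y : N π} (φ : X ⟶ Y) (hφD : IsIso ((towerN π).toD.map φ)) ⦃M₀ : N0⦄
    (β₀ : (towerN π).toF0.obj X ⟶ M₀) (α₀ : M₀ ⟶ (towerN π).toF0.obj Y)
    (hfac : β₀ ≫ α₀ = (towerN π).toF0.map φ) :
    ∃ (M : N π) (e : (towerN π).toF0.obj M = M₀) (β : X ⟶ M) (α : M ⟶ Y), β ≫ α = φ ∧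
      (towerN π).toF0.map β = β₀ ≫ eqToHom e.symm ∧ (towerN π).toF0.map α = eqToHom e ≫ α₀ := by
  have hfac' : β₀.hom.hom ≫ α₀.hom.hom = φ.hom.hom.fst := congrArg (fun k => k.hom.hom) hfac
  have hbφ : IsIso ((PreFrobenioid.baseFunctor C0.toElem).map φ.hom.hom.fst) :=
    N.isIso_base0_of_isIso_toD π φ hφD
  have hcomp : IsIso ((PreFrobenioid.baseFunctor C0.toElem).map β₀.hom.hom ≫
      (PreFrobenioid.baseFunctor C0.toElem).map α₀.hom.hom) := by
    rw [← Functor.map_comp, hfac']; exact hbφ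
  obtain ⟨hαi, -⟩ := D0.isIso_and_isIso_of_isIso_comp _ _ hcomp
  haveI := hαi
  let j : (PreFrobenioid.baseFunctor C0.toElem).obj M₀.obj.obj ≅ π.obj Y.obj.obj.snd :=
    asIso ((PreFrobenioid.baseFunctor C0.toElem).map α₀.hom.hom) ≪≫ Y.obj.obj.iso
  let M : C π := ⟨M₀.obj.obj, Y.obj.obj.snd, j⟩
  have wα : (PreFrobenioid.baseFunctor C0.toElem).map α₀.hom.hom ≫ Y.obj.obj.iso.hom =
      j.hom ≫ π.map (𝟙 Y.obj.obj.snd) := by simp [j]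
  have wβ : (PreFrobenioid.baseFunctor C0.toElem).map β₀.hom.hom ≫ j.hom =
      X.obj.obj.iso.hom ≫ π.map φ.hom.hom.snd := by
    simp only [j, Iso.trans_hom, asIso_hom]
    rw [← Category.assoc, ← Functor.map_comp, hfac']
    exact φ.hom.hom.w
  let a : M ⟶ Y.obj.obj := ⟨α₀.hom.hom, 𝟙 _, wα⟩
  let b : X.obj.obj ⟶ M := ⟨β₀.hom.hom, φ.hom.hom.snd, wβ⟩
  have ha : PreFrobenioid.isometricMorphisms (C.toElem π) a := by
    have h : PreFrobenioid.Div C0.toElem α₀.hom.hom = 1 := α₀.hom.property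
    change pull _ _ (PreFrobenioid.Div C0.toElem α₀.hom.hom) = 1
    rw [h, map_one]
  have hb : PreFrobenioid.isometricMorphisms (C.toElem π) b := by
    have h : PreFrobenioid.Div C0.toElem β₀.hom.hom = 1 := β₀.hom.property
    change pull _ _ (PreFrobenioid.Div C0.toElem β₀.hom.hom) = 1
    rw [h, map_one]
  let a' : (⟨M⟩ : A π) ⟶ Y.obj := ⟨a, ha⟩
  let b' : X.obj ⟶ (⟨M⟩ : A π) := ⟨b, hb⟩
  have hal : PreFrobenioid.linearMorphisms (A.toElem π) a' := by
    have h : C0.degFr α₀.hom.hom = 1 := α₀.property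
    exact h
  have hbl : PreFrobenioid.linearMorphisms (A.toElem π) b' := by
    have h : C0.degFr β₀.hom.hom = 1 := β₀.property
    exact h
  refine ⟨⟨⟨M⟩⟩, rfl, ⟨b', hbl⟩, ⟨a', hal⟩, ?_, (Category.comp_id _).symm, (Category.id_comp _).symm⟩
  exact WideSubcategory.hom_ext _ (WideSubcategory.hom_ext _ (CFP.hom_ext hfac' (Category.comp_id _)))

/-- **Proposition 3.4 (iv) for `F = N`**, as typed. [cite: MochizukiFrdII2008, Prop 3.4 (iv) p.30] -/
theorem N.propIV : (towerN π).PropIV := fun hC _ _ φ hφD =>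
  (towerN π).isFSM_toF0_of_lifts (fun _ _ ψ hD h0 => N.isIso_of_isIso_proj π ψ hD h0)
    (fun _ _ ψ => N.isIso_base0_of_isIso_toD π ψ) (fun _ _ f g => N.eq_of_proj_eq π f g)
    (fun X _ α₀ β₀ => N.exists_lift_pair π hC X α₀ β₀) (fun _ _ ψ hψ => N.exists_lift_fac π ψ hψ) φ hφD

/-! ### The tower facts for `F = R = R₀ ×_{D₀} D` -/

/-- (b) for `R`. [cite: MochizukiFrdII2008, Prop 3.4 (iv) p.31] -/
theorem R.isIso_base0_of_isIso_toD {X Y : R π} (φ : X ⟶ Y) (h : IsIso ((towerR π).toD.map φ)) :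
    IsIso ((towerR π).base0.map ((towerR π).toF0.map φ)) := by
  haveI : IsIso φ.snd := h
  have w : R0.toD0.map φ.fst = X.iso.hom ≫ π.map φ.snd ≫ Y.iso.inv := by
    rw [← Category.assoc, ← φ.w, Category.assoc, Iso.hom_inv_id, Category.comp_id]
  change IsIso (R0.toD0.map φ.fst)
  rw [w]
  infer_instance

/-- (c) for `R`: an arrow of `R₀ ×_{D₀} D` is determined by its two components.
[cite: MochizukiFrdII2008, Prop 3.4 (iv) p.31] -/
theorem R.eq_of_proj_eq {X Y : R π} (f g : X ⟶ Y) (h0 : (towerR π).toF0.map f = (towerR π).toF0.map g)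
    (hD : (towerR π).toD.map f = (towerR π).toD.map g) : f = g :=
  CFP.hom_ext h0 hD

/-- (d) for `R`: two arrows of `R₀` with the same base, into the projection of an object of `R`, lift to
arrows of `R` over one arrow of `D` (complexifiable `D`). [cite: MochizukiFrdII2008, Prop 3.4 (iv) p.31] -/
theorem R.exists_lift_pair (hC : RC.IsComplexifiable (π ⋙ D0.toArchBase)) (X : R π) ⦃Z₀ : R0⦄
    (α₀ β₀ : Z₀ ⟶ (towerR π).toF0.obj X) (hb : (towerR π).base0.map α₀ = (towerR π).base0.map β₀) :
    ∃ (Z : R π) (e : (towerR π).toF0.obj Z = Z₀) (α β : Z ⟶ X),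
      (towerR π).toF0.map α = eqToHom e ≫ α₀ ∧ (towerR π).toF0.map β = eqToHom e ≫ β₀ ∧
        (towerR π).toD.map α = (towerR π).toD.map β := by
  obtain ⟨d', g, i, w⟩ := exists_lift_base π hC X.snd X.iso (R0.toD0.map α₀)
  have wβ : R0.toD0.map β₀ ≫ X.iso.hom = i.hom ≫ π.map g := by
    rw [← w]; exact congrArg (· ≫ X.iso.hom) hb.symm
  let Z : R π := ⟨Z₀, d', i⟩
  let a : Z ⟶ X := ⟨α₀, g, w⟩
  let b : Z ⟶ X := ⟨β₀, g, wβ⟩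
  exact ⟨Z, rfl, a, b, (Category.id_comp _).symm, (Category.id_comp _).symm, rfl⟩

/-- (e) for `R`: a factorization in `R₀` of the first component of an arrow `φ` of `R₀ ×_{D₀} D` over an
isomorphism of `D` lifts to a factorization of `φ`. [cite: MochizukiFrdII2008, Prop 3.4 (iv) p.31] -/
theorem R.exists_lift_fac {X Y : R π} (φ : X ⟶ Y) (hφD : IsIso ((towerR π).toD.map φ)) ⦃M₀ : R0⦄
    (β₀ : (towerR π).toF0.obj X ⟶ M₀) (α₀ : M₀ ⟶ (towerR π).toF0.obj Y)
    (hfac : β₀ ≫ α₀ = (towerR π).toF0.map φ) :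
    ∃ (M : R π) (e : (towerR π).toF0.obj M = M₀) (β : X ⟶ M) (α : M ⟶ Y), β ≫ α = φ ∧
      (towerR π).toF0.map β = β₀ ≫ eqToHom e.symm ∧ (towerR π).toF0.map α = eqToHom e ≫ α₀ := by
  have hfac' : β₀ ≫ α₀ = φ.fst := hfac
  have hbφ : IsIso (R0.toD0.map φ.fst) := R.isIso_base0_of_isIso_toD π φ hφD
  have hmap : R0.toD0.map β₀ ≫ R0.toD0.map α₀ = R0.toD0.map φ.fst := by
    rw [← Functor.map_comp]
    exact congrArg (fun k => R0.toD0.map k) hfac'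
  have hcomp : IsIso (R0.toD0.map β₀ ≫ R0.toD0.map α₀) := by rw [hmap]; exact hbφ
  obtain ⟨hαi, -⟩ := D0.isIso_and_isIso_of_isIso_comp _ _ hcomp
  haveI := hαi
  let j : R0.toD0.obj M₀ ≅ π.obj Y.snd := asIso (R0.toD0.map α₀) ≪≫ Y.iso
  let M : R π := ⟨M₀, Y.snd, j⟩
  have wα : R0.toD0.map α₀ ≫ Y.iso.hom = j.hom ≫ π.map (𝟙 Y.snd) := by simp [j]
  have wβ : R0.toD0.map β₀ ≫ j.hom = X.iso.hom ≫ π.map φ.snd := by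
    simp only [j, Iso.trans_hom, asIso_hom]
    rw [← Category.assoc, hmap]
    exact φ.w
  let a : M ⟶ Y := ⟨α₀, 𝟙 _, wα⟩
  let b : X ⟶ M := ⟨β₀, φ.snd, wβ⟩
  exact ⟨M, rfl, b, a, CFP.hom_ext hfac' (Category.comp_id _), (Category.comp_id _).symm,
    (Category.id_comp _).symm⟩

/-- **Proposition 3.4 (iv) for `F = R`**, as typed. [cite: MochizukiFrdII2008, Prop 3.4 (iv) p.30] -/
theorem R.propIV : (towerR π).PropIV := fun hC _ _ φ hφD =>
  (towerR π).isFSM_toF0_of_lifts (fun _ _ ψ hD h0 => R.isIso_of_isIso_proj π ψ hD h0)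
    (fun _ _ ψ => R.isIso_base0_of_isIso_toD π ψ) (fun _ _ f g => R.eq_of_proj_eq π f g)
    (fun X _ α₀ β₀ => R.exists_lift_pair π hC X α₀ β₀) (fun _ _ ψ hψ => R.exists_lift_fac π ψ hψ) φ hφD

/-! ### Proposition 3.4 (iv) for `F = A, N, R` -/

/-- **Proposition 3.4 (iv)** PROVED AS TYPED, for `F = A, N, R` (FrdII p. 30): over a complexifiable
base, an FSM-morphism (resp. FSMI-morphism) of `F` projecting to an isomorphism of `D` projects to an
FSM-morphism (resp. FSMI-morphism) of `F₀` — node `FrdII:Prop3.4(iv)`, sub-node `P34-L05`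
(`FSMOverIsoProjectsToF0`) of the cell's SUBDAG-FrdII-Prop34.
[cite: MochizukiFrdII2008, Prop 3.4 (iv) p.30] -/
theorem prop34_iv_holds : Prop34_iv π :=
  ⟨A.propIV π, N.propIV π, R.propIV π⟩

/-- `Prop34_iv` — `_holds` alias of `prop34_iv_holds` above under the fact's exact name (appended
2026-08-28, D-0026 bookkeeping: the proof term is the existing theorem of this file; no statement,
definition or attribute is edited; no new named fact; the ledger's debt table listed the fact
unproved). [cite: MochizukiFrdII2008, Prop 3.4 (iv) p.30] -/
theorem _root_.Literature.AlgebraicGeometry.Frobenioids.ArchFrd.Prop34_iv_holds : Prop34_iv π :=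
  _root_.Literature.AlgebraicGeometry.Frobenioids.ArchFrd.prop34_iv_holds (π := π)

end ArchFrd

end Literature.AlgebraicGeometry.Frobenioids
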